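import Mathlib
import Literature.AlgebraicGeometry.Resolution.LocalBlowup
import Summits.ResolutionOfSingularities.ResolutionOfSingularities.Theorems.RadicialJungCleanModelsValuationRefinement
import HarnessLib

/-!
# Route `RadicialJung`, crux `CleanModels` (stmt-ResolutionOfSingularities-15917), line `Sketch` rev 14, stub 4a
# `stub_cleanCharts3`: MINIMAL («zero-dimensional») refinements of a valuation ring above a subring

For a valuation subring `O` of a field `K` and a subring `A ⊆ O`, Zorn's lemma gives a valuation subring `A ⊆ O₀ ≤ O`
which is MINIMAL among those (`exists_minimal_valuationSubring_between`: the intersection of a chain of valuation subrings is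
a valuation subring, `valuationSubringInter`).  For such an `O₀`, the centre `𝔪_{O₀} ∩ T` of `O₀` on EVERY intermediate
subring `A ⊆ T ⊆ O₀` is a MAXIMAL ideal of `T` (`isMaximal_subringCentre_of_minimal`): otherwise refining `O₀` to a
valuation ring centred at a maximal ideal above it (`exists_valuationSubring_le_centre_eq`, p659805) would produce a
strictly smaller member.  This is the device by which Cossart–Piltant state local uniformization only for valuations with
residue field algebraic over the ground field (J. Algebra 529 (2019), (LU) on pp. 385–386); the line uses it to make every
centre met in the construction of a clean chart a CLOSED point, where the landed closed-point spreading lemmas apply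
(`exists_zeroDim_refinement`, the form consumed by `stub_cleanCharts3`).  All PROVED; nothing here proves resolution in
characteristic `p`.
-/

noncomputable section

set_option linter.dupNamespace false -- mandated namespace of this single-conjunct summit

open IsLocalRing
open Literature.AlgebraicGeometry.Resolution

namespace Summit.ResolutionOfSingularities.ResolutionOfSingularities.Theorems.RadicialJung.CleanModels

variable {K : Type*} [Field K]

/-! ## Intersections of chains of valuation subrings -/

/-- **The intersection of a chain of valuation subrings is a valuation subring** (for `x ∉ ⋂ c` pick `V₀ ∈ c`
with `x ∉ V₀`; every `V ∈ c` is comparable with `V₀`: if `V ⊆ V₀` then `x ∉ V` so `x⁻¹ ∈ V`, if `V₀ ⊆ V` then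
`x⁻¹ ∈ V₀ ⊆ V`). [folklore] -/
def valuationSubringInter (c : Set (ValuationSubring K)) (hc : IsChain (· ≤ ·) c) : ValuationSubring K where
  carrier := {x | ∀ V ∈ c, x ∈ V}
  mul_mem' hx hy V hV := V.toSubring.mul_mem (hx V hV) (hy V hV)
  one_mem' V _ := V.toSubring.one_mem
  add_mem' hx hy V hV := V.toSubring.add_mem (hx V hV) (hy V hV)
  zero_mem' V _ := V.toSubring.zero_mem
  neg_mem' hx V hV := V.toSubring.neg_mem (hx V hV)
  mem_or_inv_mem' x := by
    by_cases hx : ∀ V ∈ c, x ∈ V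
    · exact Or.inl hx
    · right
      push Not at hx
      obtain ⟨V₀, hV₀, hxV₀⟩ := hx
      intro V hV
      rcases eq_or_ne V V₀ with rfl | hne'
      · exact (V.mem_or_inv_mem x).resolve_left hxV₀
      rcases hc hV hV₀ hne' with h | h
      · exact (V.mem_or_inv_mem x).resolve_left fun hxV => hxV₀ (h hxV)
      · exact h ((V₀.mem_or_inv_mem x).resolve_left hxV₀)

/-- Membership in the intersection. [folklore] -/
theorem mem_valuationSubringInter_iff {c : Set (ValuationSubring K)} (hc : IsChain (· ≤ ·) c)
    (x : K) : x ∈ valuationSubringInter c hc ↔ ∀ V ∈ c, x ∈ V :=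
  Iff.rfl

/-- The intersection lies below every member of the chain. [folklore] -/
theorem valuationSubringInter_le {c : Set (ValuationSubring K)} (hc : IsChain (· ≤ ·) c)
    {V : ValuationSubring K} (hV : V ∈ c) : valuationSubringInter c hc ≤ V :=
  fun _ hx => hx V hV

/-! ## Minimal refinements above a subring -/

/-- **Minimal valuation rings between a subring and a valuation ring** (Zorn): for `A ⊆ O` there is a valuation subring
`A ⊆ O₀ ≤ O` such that every valuation subring `A ⊆ V ≤ O₀` equals `O₀`. [folklore] -/
theorem exists_minimal_valuationSubring_between (O : ValuationSubring K) (A : Subring K) (hAO : A ≤ O.toSubring) :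
    ∃ O₀ : ValuationSubring K, O₀ ≤ O ∧ A ≤ O₀.toSubring ∧
      ∀ V : ValuationSubring K, V ≤ O₀ → A ≤ V.toSubring → V = O₀ := by
  classical
  -- Zorn in the dual order
  let s : Set (ValuationSubring K)ᵒᵈ := {V | A ≤ (OrderDual.ofDual V).toSubring ∧ OrderDual.ofDual V ≤ O}
  have hOs : OrderDual.toDual O ∈ s := ⟨hAO, le_rfl⟩
  have hchain : ∀ c ⊆ s, IsChain (· ≤ ·) c → ∀ y ∈ c, ∃ ub ∈ s, ∀ z ∈ c, z ≤ ub := by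
    intro c hcs hc y hy
    -- a chain `c ⊆ s` (non-empty: `y ∈ c`) has the intersection as an upper bound in the dual order
    let c' : Set (ValuationSubring K) := OrderDual.ofDual '' c
    have hc' : IsChain (· ≤ ·) c' := by
      rintro _ ⟨a, ha, rfl⟩ _ ⟨b, hb, rfl⟩ hab
      have hab' : a ≠ b := fun h => hab (by rw [h])
      rcases hc ha hb hab' with h | h
      · exact Or.inr h
      · exact Or.inl h
    refine ⟨OrderDual.toDual (valuationSubringInter c' hc'), ⟨fun a ha => ?_, ?_⟩, fun z hz => ?_⟩
    · exact (mem_valuationSubringInter_iff hc' a).mpr fun V ⟨w, hw, hwV⟩ => hwV ▸ (hcs hw).1 ha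
    · exact (valuationSubringInter_le hc' ⟨y, hy, rfl⟩).trans (hcs hy).2
    · exact valuationSubringInter_le hc' ⟨z, hz, rfl⟩
  obtain ⟨m, hOm, hmax⟩ := zorn_le_nonempty₀ s hchain (OrderDual.toDual O) hOs
  refine ⟨OrderDual.ofDual m, hOm, hmax.prop.1, fun V hVm hAV => ?_⟩
  have hVs : OrderDual.toDual V ∈ s := ⟨hAV, hVm.trans hmax.prop.2⟩
  have h1 : m ≤ OrderDual.toDual V := hVm
  have h2 := hmax.le_of_ge hVs h1
  exact le_antisymm hVm h2

/-- **A minimal refinement is centred at MAXIMAL ideals**: if `O₀` is minimal among the valuation subrings `A ⊆ V ≤ O₀`,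
then for every intermediate subring `A ⊆ T ⊆ O₀` the centre `𝔪_{O₀} ∩ T` is a maximal ideal of `T` (else refine `O₀` to
a valuation ring centred at a maximal ideal above the centre, `exists_valuationSubring_le_centre_eq`). [folklore] -/
theorem isMaximal_subringCentre_of_minimal {O₀ : ValuationSubring K} {A : Subring K}
    (hmin : ∀ V : ValuationSubring K, V ≤ O₀ → A ≤ V.toSubring → V = O₀)
    (T : Subring K) (hT : T ≤ O₀.toSubring) (hAT : A ≤ T) : (subringCentre T O₀ hT).IsMaximal := by
  classical
  by_contra hnm
  obtain ⟨𝔫, h𝔫, hle⟩ := Ideal.exists_le_maximal (subringCentre T O₀ hT) Ideal.IsPrime.ne_top'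
  have hne : subringCentre T O₀ hT ≠ 𝔫 := fun h => hnm (h ▸ h𝔫)
  -- refine `O₀` to a valuation ring centred at `𝔫`
  have hcentre : ∀ a : T, O₀.valuation (a : K) < 1 → a ∈ 𝔫 :=
    fun a ha => hle ((mem_subringCentre_iff hT a).mpr ha)
  obtain ⟨O', hO'O₀, hTO', hc𝔫⟩ := exists_valuationSubring_le_centre_eq O₀ T hT 𝔫 hcentre
  have hO' : O' = O₀ := hmin O' hO'O₀ (hAT.trans hTO')
  apply hne
  ext a
  rw [mem_subringCentre_iff, hc𝔫, hO']

/-- **Zero-dimensional refinement above a subring** (the form used by `stub_cleanCharts3`): every valuation subring `O`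
containing `A` has a refinement `A ⊆ O₀ ≤ O` all of whose centres on intermediate subrings `A ⊆ T ⊆ O₀` are maximal
ideals (so a finitely generated `T` meets `O₀` in a CLOSED point). [folklore] -/
theorem exists_zeroDim_refinement (O : ValuationSubring K) (A : Subring K) (hAO : A ≤ O.toSubring) :
    ∃ O₀ : ValuationSubring K, O₀ ≤ O ∧ A ≤ O₀.toSubring ∧
      ∀ (T : Subring K) (hT : T ≤ O₀.toSubring), A ≤ T → (subringCentre T O₀ hT).IsMaximal := by
  obtain ⟨O₀, hO₀O, hAO₀, hmin⟩ := exists_minimal_valuationSubring_between O A hAO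
  exact ⟨O₀, hO₀O, hAO₀, fun T hT hAT => isMaximal_subringCentre_of_minimal hmin T hT hAT⟩

end Summit.ResolutionOfSingularities.ResolutionOfSingularities.Theorems.RadicialJung.CleanModels

end
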